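import Literature.Probability.RandomPlanarGeometry.USTPeanoLattice
import Literature.Probability.RandomPlanarGeometry.PolygonalDomains
import HarnessLib

/-!
# The domains `D(α, β, a, b) ∈ 𝔇*` of [LSW04] §4.1 (simple-path case)

G. F. Lawler, O. Schramm, W. Werner, Ann. Probab. **32** (2004) (**[LSW04]**), §4.1, pp. 970–971:

> "Let `α` be some finite tree in the primal grid `ℤ²` and let `β` be a finite tree in the dual
> grid, [no edge of `α` meeting an edge of `β`], … two Peano vertices `a, b` such that `a` is
> adjacent to both a primal vertex `α_a ∈ α` and a dual vertex `β_a ∈ β`, and `b` is adjacent to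
> both `α_b ∈ α` and `β_b ∈ β`. … Let `D = D(α, β, a, b)` be the (unique) bounded connected
> component of `ℂ ∖ (α ∪ [α_b, β_b] ∪ β ∪ [β_a, α_a])`. … assume that `D` lies to the immediate
> right of the oriented segment `[α_a, β_a]`. Let `𝔇*` denote the collection of all domains
> obtained in this way."

This file formalises this class in the case — the only one needed for [LSW04] §4.3, Prop. 4.5
and Thms. 4.7–4.8, hence for `Literature.Probability.RandomPlanarGeometry.hasSLETrace_eight` —
where `α` and `β` are **simple lattice paths** (§4.3, p. 977: "We require `α^R` to be a simple
path in `ℤ²` … and require `β^R` to be a simple path in the dual grid"), so that the removed set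
is a simple closed polygon and `D` is its inside, a Jordan domain (`polygonDomain`,
`PolygonalDomains.lean`), to which the tree's uniformization theorem
`MarkedDomain.exists_isChordalUniformizing_holds` applies:

* the boundary polygon `boundaryVerts α β a b = [a, α_a, …, α_b, b, β_b, …, β_a]` and the
  structure `USTPeano.Domain` = `𝔇*` restricted to simple paths: `α`, `β` nonempty lattice paths
  from the neighbours of `a` to the neighbours of `b` (each Peano vertex has exactly one primal
  and one dual neighbour, `USTPeanoLattice.lean`), the boundary polygon simple, and `D`
  immediately to the right of `[α_a, β_a]` (`rightTestPt_mem`: the point at distance `√2/8` from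
  `a` along the right normal of `[α_a, β_a]` lies inside);
* `Domain.carrier` (the open set `D`), `Domain.mem_carrier_iff` (LSW's wording: off the removed
  set, in a bounded complementary component), `Domain.toDobrushinDomain` (the Jordan domain `D`
  with marked boundary points `a = pt 0`, `b = pt 1`), the finite set `Domain.peanoVerts` of Peano
  vertices in `D` (`V_P(D)`), and the point sets `primalPathSet α`, `dualPathSet β`,
  `Domain.latticeBoundary` (`α ∪ β ⊆ ℂ`) that Peano paths must avoid.

Not formalised: general trees `α`, `β` (then `D` is not a Jordan domain and `a`, `b` are prime
ends). A worked example (the smallest domain, a triangle) is in `USTPeanoExample.lean`.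
-/

noncomputable section

open Set Function Complex

namespace Literature.Probability.RandomPlanarGeometry

namespace USTPeano

/-! ### The boundary polygon and the class `𝔇*` (simple-path case) -/

/-- The **boundary vertex cycle** of `D(α, β, a, b)`: `a, α_a = α[0], …, α_b, b, β_b, …, β_a = β[0]`
(then back to `a`). Its closed polygon `polygonLoop (boundaryVerts α β a b)` runs along
`[a, α_a] ∪ α ∪ [α_b, b] ∪ [b, β_b] ∪ β ∪ [β_a, a] = α ∪ [α_b, β_b] ∪ β ∪ [β_a, α_a]`, the set removed
from `ℂ` in [LSW04] p. 971; since `D` is to the right of `[α_a, β_a]`, which this cycle traverses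
backwards (`β_a → a → α_a`), the domain is on the LEFT of this traversal (counterclockwise).
[cite: LawlerSchrammWerner2004, §4.1] -/
def boundaryVerts (α β : List (ℤ × ℤ)) (a b : ℤ × ℤ) : List ℂ :=
  peanoPt a :: (α.map primalPt ++ peanoPt b :: (β.map dualPt).reverse)

/-- The boundary cycle has `|α| + |β| + 2` vertices. [folklore] -/
@[simp] theorem length_boundaryVerts (α β : List (ℤ × ℤ)) (a b : ℤ × ℤ) :
    (boundaryVerts α β a b).length = α.length + β.length + 2 := by
  simp [boundaryVerts]
  omega

/-- Vertex `0` of the boundary cycle is `a`. [folklore] -/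
@[simp] theorem boundaryVerts_zero (α β : List (ℤ × ℤ)) (a b : ℤ × ℤ) :
    (boundaryVerts α β a b)[0]'(by simp) = peanoPt a := by
  simp [boundaryVerts]

/-- Vertex `|α| + 1` of the boundary cycle is `b`. [folklore] -/
@[simp] theorem boundaryVerts_length_succ (α β : List (ℤ × ℤ)) (a b : ℤ × ℤ) :
    (boundaryVerts α β a b)[α.length + 1]'(by simp) = peanoPt b := by
  simp [boundaryVerts, List.getElem_append_right (by simp : (α.map primalPt).length ≤ α.length)]

/-- **The orientation test point** at `a`: the point `a + ¼ (-i) (β_a - α_a)`, at distance `√2/8`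
from `a` along the right-hand normal of the oriented segment `[α_a, β_a]`. It lies on no lattice
line of any of the three grids and on neither connecting segment, and the half-open segment from
`a` to it meets the removed set only at `a`; so "`D` lies to the immediate right of `[α_a, β_a]`"
([LSW04] p. 971) is the condition that this point lies in `D` (`Domain.rightTestPt_mem`). Both
Manhattan edges leaving `a` point to this side. [cite: LawlerSchrammWerner2004, §4.1] -/
def rightTestPt (a : ℤ × ℤ) : ℂ :=
  peanoPt a + (1 / 4 : ℂ) * (-I * (dualPt (dualNbr a) - primalPt (primalNbr a)))

/-- **The lattice domains `D(α, β, a, b) ∈ 𝔇*` of [LSW04] §4.1 with `α`, `β` simple paths** (the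
setting of §4.3). Data: a nonempty primal lattice path `α = [α_a, …, α_b]` and a nonempty dual
lattice path `β = [β_a, …, β_b]` (as index lists, consecutive sites adjacent), Peano vertices
`a`, `b` with `α_a`, `β_a` the primal/dual vertices adjacent to `a` and `α_b`, `β_b` those
adjacent to `b`. Conditions: the boundary polygon `a, α, b, β⁻¹` is SIMPLE (this contains LSW's
"`α`, `β` simple, no edge of `α` intersects an edge of `β`", and `a ≠ b`), and `D` — the inside of
the polygon, i.e. the bounded complementary component (`polygonDomain`,
`JordanDomain.mem_ofLoop_carrier_iff`) — lies immediately to the right of `[α_a, β_a]`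
(`rightTestPt_mem`). [LSW04] §4.1, pp. 970–971; §4.3, p. 977. [cite: LawlerSchrammWerner2004, §4.1] -/
structure Domain where
  /-- the primal boundary path `α` (the wired arc), listed from `α_a` to `α_b` -/
  α : List (ℤ × ℤ)
  /-- the dual boundary path `β` (the free arc), listed from `β_a` to `β_b` -/
  β : List (ℤ × ℤ)
  /-- the initial Peano vertex `a` -/
  a : ℤ × ℤ
  /-- the terminal Peano vertex `b` -/
  b : ℤ × ℤ
  α_ne_nil : α ≠ []
  β_ne_nil : β ≠ []
  /-- `α` is a lattice path -/
  isChain_α : α.IsChain LatticeAdj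
  /-- `β` is a (dual) lattice path -/
  isChain_β : β.IsChain LatticeAdj
  /-- `α` starts at the primal vertex adjacent to `a` -/
  head_α : α.head α_ne_nil = primalNbr a
  /-- `β` starts at the dual vertex adjacent to `a` -/
  head_β : β.head β_ne_nil = dualNbr a
  /-- `α` ends at the primal vertex adjacent to `b` -/
  getLast_α : α.getLast α_ne_nil = primalNbr b
  /-- `β` ends at the dual vertex adjacent to `b` -/
  getLast_β : β.getLast β_ne_nil = dualNbr b
  /-- the boundary polygon is simple -/
  simple : IsSimpleClosedPolygon (boundaryVerts α β a b)
  /-- `D` lies immediately to the right of the oriented segment `[α_a, β_a]` -/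
  rightTestPt_mem : rightTestPt a ∈ (polygonDomain (boundaryVerts α β a b) simple).carrier

namespace Domain

variable (D : Domain)

/-- `D(α, β, a, b)` as a Jordan domain (the inside of the boundary polygon). [LSW04] p. 971.
[cite: LawlerSchrammWerner2004, §4.1] -/
def toJordanDomain : JordanDomain := polygonDomain (boundaryVerts D.α D.β D.a D.b) D.simple

/-- The open set `D = D(α, β, a, b)`: "the (unique) bounded connected component of
`ℂ ∖ (α ∪ [α_b, β_b] ∪ β ∪ [β_a, α_a])`" ([LSW04] p. 971). [cite: LawlerSchrammWerner2004, §4.1] -/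
def carrier : Set ℂ := D.toJordanDomain.carrier

/-- The boundary loop of `D` is the boundary polygon. [folklore] -/
@[simp] theorem toJordanDomain_boundary :
    D.toJordanDomain.boundary = polygonLoop (boundaryVerts D.α D.β D.a D.b) := rfl

/-- `D.toJordanDomain.carrier = D.carrier`. [folklore] -/
@[simp] theorem toJordanDomain_carrier : D.toJordanDomain.carrier = D.carrier := rfl

/-- `D` is open. [folklore] -/
theorem isOpen_carrier : IsOpen D.carrier := D.toJordanDomain.isOpen

/-- `D` is bounded. [folklore] -/
theorem isBounded_carrier : Bornology.IsBounded D.carrier := D.toJordanDomain.isBounded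

/-- `D` is connected. [folklore] -/
theorem isConnected_carrier : IsConnected D.carrier := D.toJordanDomain.isConnected

/-- The frontier of `D` is the boundary polygon. [folklore] -/
theorem frontier_carrier :
    frontier D.carrier = range (polygonLoop (boundaryVerts D.α D.β D.a D.b)) :=
  D.toJordanDomain.range_boundary.symm

/-- Membership in `D`: off the boundary polygon and in a bounded complementary component —
literally LSW's description. [cite: LawlerSchrammWerner2004, §4.1] -/
theorem mem_carrier_iff {z : ℂ} :
    z ∈ D.carrier ↔ z ∉ range (polygonLoop (boundaryVerts D.α D.β D.a D.b)) ∧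
      Bornology.IsBounded
        (connectedComponentIn (range (polygonLoop (boundaryVerts D.α D.β D.a D.b)))ᶜ z) :=
  mem_polygonDomain_iff _ _

/-- `a` is a boundary point of `D`. [folklore] -/
theorem peanoPt_a_mem_frontier : peanoPt D.a ∈ frontier D.carrier := by
  rw [frontier_carrier, ← boundaryVerts_zero D.α D.β D.a D.b]
  exact getElem_mem_range_polygonLoop _

/-- `b` is a boundary point of `D`. [folklore] -/
theorem peanoPt_b_mem_frontier : peanoPt D.b ∈ frontier D.carrier := by
  rw [frontier_carrier, ← boundaryVerts_length_succ D.α D.β D.a D.b]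
  exact getElem_mem_range_polygonLoop _

/-- `a ∉ D`. [folklore] -/
theorem peanoPt_a_notMem : peanoPt D.a ∉ D.carrier := fun h ↦
  Set.disjoint_left.1 D.toJordanDomain.disjoint_carrier_frontier h D.peanoPt_a_mem_frontier

/-- `b ∉ D`. [folklore] -/
theorem peanoPt_b_notMem : peanoPt D.b ∉ D.carrier := fun h ↦
  Set.disjoint_left.1 D.toJordanDomain.disjoint_carrier_frontier h D.peanoPt_b_mem_frontier

/-- `a ≠ b` (the boundary polygon is simple). [folklore] -/
theorem a_ne_b : D.a ≠ D.b := by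
  intro h
  have := D.simple.getElem_ne (i := 0) (j := D.α.length + 1) (by simp) (by simp) (by omega)
  rw [boundaryVerts_zero, boundaryVerts_length_succ, h] at this
  exact this rfl

/-- **`(D; a, b)` as a Dobrushin domain**: the Jordan domain `D` with the marked boundary points
`a = pt 0` (parameter `0`) and `b = pt 1` (parameter `(|α| + 1)/N`). This is the structure the
tree's uniformization theorem `MarkedDomain.exists_isChordalUniformizing_holds` consumes, giving
the conformal maps `φ : ℍ → D` with `0 ↦ a`, `∞ ↦ b` of [LSW04] §4.2. [cite: LawlerSchrammWerner2004, §4.2] -/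
def toDobrushinDomain : DobrushinDomain where
  toJordanDomain := D.toJordanDomain
  mark := ![0, (D.α.length + 1 : ℝ) / (boundaryVerts D.α D.β D.a D.b).length]
  strictMono_mark := by
    refine Fin.strictMono_iff_lt_succ.2 fun k ↦ ?_
    fin_cases k
    simp only [length_boundaryVerts, Nat.cast_add, Nat.cast_ofNat, Fin.zero_eta, Fin.isValue,
      Fin.castSucc_zero, Matrix.cons_val_zero, Fin.succ_zero_eq_one, Matrix.cons_val_one,
      Matrix.cons_val_fin_one]
    positivity
  mark_mem k := by
    fin_cases k
    · simp
    · simp only [length_boundaryVerts, Nat.cast_add, Nat.cast_ofNat, Fin.mk_one,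
        Matrix.cons_val_one, Matrix.cons_val_fin_one, mem_Ico]
      refine ⟨by positivity, ?_⟩
      rw [div_lt_one (by positivity)]
      have : (0 : ℝ) ≤ D.β.length := by positivity
      linarith

/-- The first marked point is `a`. [folklore] -/
@[simp] theorem toDobrushinDomain_pt_zero : D.toDobrushinDomain.pt 0 = peanoPt D.a := by
  simp only [MarkedDomain.pt, toDobrushinDomain, toJordanDomain_boundary]
  simpa using polygonLoop_vertex (l := boundaryVerts D.α D.β D.a D.b) (k := 0) (by simp)

/-- The second marked point is `b`. [folklore] -/
@[simp] theorem toDobrushinDomain_pt_one : D.toDobrushinDomain.pt 1 = peanoPt D.b := by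
  simp only [MarkedDomain.pt, toDobrushinDomain, toJordanDomain_boundary]
  have := polygonLoop_vertex (l := boundaryVerts D.α D.β D.a D.b) (k := D.α.length + 1) (by simp)
  simp only [boundaryVerts_length_succ, length_boundaryVerts] at this
  simpa using this

/-- The carrier of the Dobrushin domain is `D`. [folklore] -/
@[simp] theorem toDobrushinDomain_carrier : D.toDobrushinDomain.carrier = D.carrier := rfl

/-! ### Peano vertices in `D` and the boundary paths as point sets -/

/-- The set `V_P(D)` of (indices of) **Peano vertices in `D`** ([LSW04] p. 971). [cite: LawlerSchrammWerner2004, §4.1] -/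
def peanoVerts : Set (ℤ × ℤ) := {p | peanoPt p ∈ D.carrier}

/-- Membership in `V_P(D)`. [folklore] -/
@[simp] theorem mem_peanoVerts {p : ℤ × ℤ} : p ∈ D.peanoVerts ↔ peanoPt p ∈ D.carrier := Iff.rfl

/-- `a ∉ V_P(D)` (it is a boundary point). [folklore] -/
theorem a_notMem_peanoVerts : D.a ∉ D.peanoVerts := D.peanoPt_a_notMem

/-- `b ∉ V_P(D)`. [folklore] -/
theorem b_notMem_peanoVerts : D.b ∉ D.peanoVerts := D.peanoPt_b_notMem

/-- **`V_P(D)` is finite** (`D` is bounded). [folklore] -/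
theorem finite_peanoVerts : D.peanoVerts.Finite := by
  obtain ⟨R, hR⟩ := D.isBounded_carrier.subset_closedBall 0
  obtain ⟨n, hn⟩ := exists_nat_gt (2 * R + 1)
  refine ((Set.finite_Icc (-(n : ℤ)) n).prod (Set.finite_Icc (-(n : ℤ)) n)).subset ?_
  rintro ⟨i, j⟩ hp
  have hz := hR hp
  rw [Metric.mem_closedBall, dist_zero_right] at hz
  have hre := (Complex.abs_re_le_norm (peanoPt (i, j))).trans hz
  have him := (Complex.abs_im_le_norm (peanoPt (i, j))).trans hz
  simp only [peanoPt_re, peanoPt_im, abs_le] at hre him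
  have hi : |(i : ℝ)| ≤ n := by rw [abs_le]; constructor <;> linarith [hre.1, hre.2]
  have hj : |(j : ℝ)| ≤ n := by rw [abs_le]; constructor <;> linarith [him.1, him.2]
  have hi' : |i| ≤ n := by exact_mod_cast hi
  have hj' : |j| ≤ n := by exact_mod_cast hj
  exact ⟨⟨(abs_le.1 hi').1, (abs_le.1 hi').2⟩, ⟨(abs_le.1 hj').1, (abs_le.1 hj').2⟩⟩

/-- The **point set of a primal lattice path**: its vertices and its closed edges (for a
one-vertex path, just the vertex). This is `α ⊆ ℂ` in "`ℂ ∖ (α ∪ …)`" and in "edges of `G` which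
do not intersect `T ⊇ α`" ([LSW04] p. 971). [cite: LawlerSchrammWerner2004, §4.1] -/
def primalPathSet (α : List (ℤ × ℤ)) : Set ℂ :=
  {z | ∃ v ∈ α, z = primalPt v} ∪ ⋃ e ∈ α.zip α.tail, segment ℝ (primalPt e.1) (primalPt e.2)

/-- The **point set of a dual lattice path**: its vertices and its closed edges. [cite: LawlerSchrammWerner2004, §4.1] -/
def dualPathSet (β : List (ℤ × ℤ)) : Set ℂ :=
  {z | ∃ v ∈ β, z = dualPt v} ∪ ⋃ e ∈ β.zip β.tail, segment ℝ (dualPt e.1) (dualPt e.2)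

/-- The vertices of `α` lie on its point set. [folklore] -/
theorem primalPt_mem_primalPathSet {α : List (ℤ × ℤ)} {v : ℤ × ℤ} (hv : v ∈ α) :
    primalPt v ∈ primalPathSet α :=
  Or.inl ⟨v, hv, rfl⟩

/-- The vertices of `β` lie on its point set. [folklore] -/
theorem dualPt_mem_dualPathSet {β : List (ℤ × ℤ)} {v : ℤ × ℤ} (hv : v ∈ β) :
    dualPt v ∈ dualPathSet β :=
  Or.inl ⟨v, hv, rfl⟩

/-- The removed lattice set `α ∪ β` of `D` (without the two connecting segments): the Peano path
must not cross it. [cite: LawlerSchrammWerner2004, §4.1] -/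
def latticeBoundary : Set ℂ := primalPathSet D.α ∪ dualPathSet D.β

end Domain

end USTPeano

end Literature.Probability.RandomPlanarGeometry
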